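import Summits.AtomisticToContinuum.HydrodynamicLimit.Theorems.OneFlightGossipEngineClampedCurrentsDockHiSplit
import HarnessLib

/-!
# The coherent/incoherent split of the suprathermal heat flux with a RADIAL WEIGHT (stub
# `stub_hiHeatFluxSplitW`, line `IdeatorTwoSketch`, crux `ClampedCurrentsDock`, stmt-AtomisticToContinuum-14680)

Helper file (`--supports stmt-AtomisticToContinuum-14680`) proving the registered stub
`stub_hiHeatFluxSplitW : HiHeatFluxSplitW` (S12′, skeleton v19) of the lead's skeleton
(`Cruxes/ClampedCurrentsDock/Lines/IdeatorTwoSketch.lean`): the radially weighted version of the landed sharp split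
`ClampedCurrentsDockHiSplit.stub_hiHeatFluxSplit`. Pure real analysis on a window `[s, s+w]`: with `Q_i = R_i • W_i`,
`R_i(r) = 0` wherever `‖W_i(r)‖ ≤ K` and `|R_i| ≤ C‖W_i‖²`, each signal is either INCOHERENT (`‖∫ Q_i‖ ≤ η ∫‖W_i‖³`,
paid at rate `η`) or COHERENT (paid by `C ∫ 1{K<‖W_i‖}‖W_i‖³`, since pointwise `‖Q_i‖ ≤ C·1{K<‖W_i‖}‖W_i‖³`).
-/

noncomputable section

namespace Summit.AtomisticToContinuum.HydrodynamicLimit.Theorems.ClampedCurrentsDockHiSplitW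

open MeasureTheory Filter Set Topology Finset
open scoped Interval
open Literature.MathematicalPhysics.KineticTheory Literature.Analysis.FluidPDE Literature.Analysis.FunctionSpaces

/-- registered stub signature S12′ of line IdeatorTwoSketch, crux ClampedCurrentsDock — route-internal, not a cited fact -/
def HiHeatFluxSplitW : Prop :=
  ∀ (n : ℕ) (s w K η B C : ℝ) (W : Fin n → ℝ → V3) (Rr : Fin n → ℝ → ℝ) (β : Fin n → V3),
    0 ≤ w → 0 < K → 0 < η → 0 ≤ C →
    (∀ i, Measurable (W i)) → (∀ i, Measurable (Rr i)) →
    (∀ i, IntervalIntegrable (fun r => ‖W i r‖ ^ 3) volume s (s + w)) →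
    (∀ i r, ‖W i r‖ ≤ K → Rr i r = 0) → (∀ i r, |Rr i r| ≤ C * ‖W i r‖ ^ 2) → (∀ i, ‖β i‖ ≤ B) →
      (let Q := fun (i : Fin n) (r : ℝ) => Rr i r • W i r
       |∑ i, inner ℝ (β i) (∫ r in s..(s + w), Q i r)| ≤
         B * (η * (∑ i, ∫ r in s..(s + w), ‖W i r‖ ^ 3) +
           C * ∑ i,
             (if η * ∫ r in s..(s + w), ‖W i r‖ ^ 3 < ‖∫ r in s..(s + w), Q i r‖ then
               ∫ r in s..(s + w), (if K < ‖W i r‖ then ‖W i r‖ ^ 3 else 0) else 0)))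

/-- Pointwise domination of the weighted flux signal: if the scalar weight `t` vanishes whenever `‖W‖ ≤ K` and
`|t| ≤ C‖W‖²`, then `‖t • W‖ ≤ C · (if K < ‖W‖ then ‖W‖³ else 0)`. [folklore] -/
theorem norm_wflux_le {K C t : ℝ} {Wv : V3} (hzero : ‖Wv‖ ≤ K → t = 0) (ht : |t| ≤ C * ‖Wv‖ ^ 2) :
    ‖t • Wv‖ ≤ C * (if K < ‖Wv‖ then ‖Wv‖ ^ 3 else 0) := by
  rw [norm_smul, Real.norm_eq_abs]
  split_ifs with h
  · calc |t| * ‖Wv‖ ≤ C * ‖Wv‖ ^ 2 * ‖Wv‖ := mul_le_mul_of_nonneg_right ht (norm_nonneg _)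
      _ = C * ‖Wv‖ ^ 3 := by ring
  · rw [hzero (not_lt.1 h), abs_zero, zero_mul, mul_zero]

/-- **One signal.** With `Q = R • W` measurable, `R = 0` below the cut-off `K` and `|R| ≤ C‖W‖²` (so `Q` is
dominated by `C‖W‖³`, interval-integrable), on `[s, s+w]`:
`‖∫ Q‖ ≤ η ∫‖W‖³ + C · (if η ∫‖W‖³ < ‖∫ Q‖ then ∫ 1{K<‖W‖}‖W‖³ else 0)`. [folklore] -/
theorem norm_integral_wflux_le {s w K η C : ℝ} (hw : 0 ≤ w) (hη : 0 < η) (hC : 0 ≤ C)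
    {Wf : ℝ → V3} {Rf : ℝ → ℝ} (hWm : Measurable Wf) (hRm : Measurable Rf)
    (hint : IntervalIntegrable (fun r => ‖Wf r‖ ^ 3) volume s (s + w))
    (hzero : ∀ r, ‖Wf r‖ ≤ K → Rf r = 0) (hdom : ∀ r, |Rf r| ≤ C * ‖Wf r‖ ^ 2) :
    ‖∫ r in s..(s + w), Rf r • Wf r‖ ≤
      η * (∫ r in s..(s + w), ‖Wf r‖ ^ 3) +
        C * (if η * ∫ r in s..(s + w), ‖Wf r‖ ^ 3 < ‖∫ r in s..(s + w), Rf r • Wf r‖ then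
            ∫ r in s..(s + w), (if K < ‖Wf r‖ then ‖Wf r‖ ^ 3 else 0) else 0) := by
  have hsw : s ≤ s + w := by linarith
  set Q : ℝ → V3 := fun r => Rf r • Wf r with hQ
  set hi : ℝ → ℝ := fun r => if K < ‖Wf r‖ then ‖Wf r‖ ^ 3 else 0 with hhi
  -- measurability
  have hset : MeasurableSet {r | K < ‖Wf r‖} := measurableSet_lt measurable_const hWm.norm
  have hQm : Measurable Q := hRm.smul hWm
  have hhim : Measurable hi := Measurable.ite hset (hWm.norm.pow_const 3) measurable_const
  -- pointwise bounds
  have hQle : ∀ r, ‖Q r‖ ≤ C * hi r := fun r => norm_wflux_le (hzero r) (hdom r)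
  have hhi0 : ∀ r, 0 ≤ hi r := fun r => by simp only [hhi]; split_ifs <;> positivity
  have hhile : ∀ r, hi r ≤ ‖Wf r‖ ^ 3 := by
    intro r
    simp only [hhi]
    split_ifs
    · exact le_rfl
    · positivity
  -- integrability by domination
  have hhiint : IntervalIntegrable hi volume s (s + w) := by
    refine hint.mono_fun hhim.aestronglyMeasurable (Eventually.of_forall fun r => ?_)
    show ‖hi r‖ ≤ ‖‖Wf r‖ ^ 3‖
    rw [Real.norm_eq_abs, Real.norm_eq_abs, abs_of_nonneg (hhi0 r),
      abs_of_nonneg (by positivity : (0 : ℝ) ≤ ‖Wf r‖ ^ 3)]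
    exact hhile r
  have hCint : IntervalIntegrable (fun r => C * hi r) volume s (s + w) := hhiint.const_mul C
  have hQint : IntervalIntegrable (fun r => ‖Q r‖) volume s (s + w) := by
    refine hCint.mono_fun hQm.norm.aestronglyMeasurable (Eventually.of_forall fun r => ?_)
    show ‖‖Q r‖‖ ≤ ‖C * hi r‖
    rw [norm_norm, Real.norm_eq_abs, abs_of_nonneg (mul_nonneg hC (hhi0 r))]
    exact hQle r
  -- nonnegativity of the cubic content
  have hI3 : 0 ≤ ∫ r in s..(s + w), ‖Wf r‖ ^ 3 :=
    intervalIntegral.integral_nonneg hsw fun r _ => by positivity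
  -- the case split
  have h1 : ‖∫ r in s..(s + w), Q r‖ ≤ ∫ r in s..(s + w), ‖Q r‖ :=
    intervalIntegral.norm_integral_le_integral_norm hsw
  have h2 : ∫ r in s..(s + w), ‖Q r‖ ≤ ∫ r in s..(s + w), C * hi r :=
    intervalIntegral.integral_mono_on hsw hQint hCint fun r _ => hQle r
  rw [intervalIntegral.integral_const_mul] at h2
  have h3 : 0 ≤ η * ∫ r in s..(s + w), ‖Wf r‖ ^ 3 := mul_nonneg hη.le hI3
  show ‖∫ r in s..(s + w), Q r‖ ≤ η * (∫ r in s..(s + w), ‖Wf r‖ ^ 3) +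
    C * (if η * ∫ r in s..(s + w), ‖Wf r‖ ^ 3 < ‖∫ r in s..(s + w), Q r‖ then
      ∫ r in s..(s + w), hi r else 0)
  by_cases hcoh : η * ∫ r in s..(s + w), ‖Wf r‖ ^ 3 < ‖∫ r in s..(s + w), Q r‖
  · rw [if_pos hcoh]
    linarith
  · rw [if_neg hcoh, mul_zero, add_zero]
    exact not_lt.1 hcoh

/-- **STUB S12′ `stub_hiHeatFluxSplitW`** of line `IdeatorTwoSketch` (crux `ClampedCurrentsDock`, stmt-14680):
termwise Cauchy–Schwarz `|β_i · ∫Q_i| ≤ B‖∫Q_i‖`, the one-signal split `norm_integral_wflux_le`, summed. [folklore] -/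
theorem stub_hiHeatFluxSplitW : HiHeatFluxSplitW := by
  intro n s w K η B C W Rr β hw _hK hη hC hWm hRm hint hzero hdom hβ
  simp only
  -- termwise bound
  have hterm : ∀ i, |inner ℝ (β i) (∫ r in s..(s + w), Rr i r • W i r)| ≤
      B * (η * (∫ r in s..(s + w), ‖W i r‖ ^ 3) +
        C * (if η * ∫ r in s..(s + w), ‖W i r‖ ^ 3 < ‖∫ r in s..(s + w), Rr i r • W i r‖ then
            ∫ r in s..(s + w), (if K < ‖W i r‖ then ‖W i r‖ ^ 3 else 0) else 0)) := by
    intro i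
    have hcs := abs_real_inner_le_norm (β i) (∫ r in s..(s + w), Rr i r • W i r)
    have hone := norm_integral_wflux_le (K := K) (η := η) hw hη hC (hWm i) (hRm i) (hint i) (hzero i) (hdom i)
    calc _ ≤ ‖β i‖ * ‖∫ r in s..(s + w), Rr i r • W i r‖ := hcs
      _ ≤ B * ‖∫ r in s..(s + w), Rr i r • W i r‖ := mul_le_mul_of_nonneg_right (hβ i) (norm_nonneg _)
      _ ≤ _ := mul_le_mul_of_nonneg_left hone ((norm_nonneg _).trans (hβ i))
  calc |∑ i, inner ℝ (β i) (∫ r in s..(s + w), Rr i r • W i r)|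
      ≤ ∑ i, |inner ℝ (β i) (∫ r in s..(s + w), Rr i r • W i r)| := Finset.abs_sum_le_sum_abs _ _
    _ ≤ ∑ i, B * (η * (∫ r in s..(s + w), ‖W i r‖ ^ 3) +
        C * (if η * ∫ r in s..(s + w), ‖W i r‖ ^ 3 < ‖∫ r in s..(s + w), Rr i r • W i r‖ then
            ∫ r in s..(s + w), (if K < ‖W i r‖ then ‖W i r‖ ^ 3 else 0) else 0)) :=
        Finset.sum_le_sum fun i _ => hterm i
    _ = B * (η * (∑ i, ∫ r in s..(s + w), ‖W i r‖ ^ 3) +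
          C * ∑ i, (if η * ∫ r in s..(s + w), ‖W i r‖ ^ 3 < ‖∫ r in s..(s + w), Rr i r • W i r‖ then
            ∫ r in s..(s + w), (if K < ‖W i r‖ then ‖W i r‖ ^ 3 else 0) else 0)) := by
        rw [Finset.mul_sum, Finset.mul_sum, ← Finset.sum_add_distrib, Finset.mul_sum]

end Summit.AtomisticToContinuum.HydrodynamicLimit.Theorems.ClampedCurrentsDockHiSplitW

end
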